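import Summits.MatrixMultiplication.MatrixMultiplication.Theses.FourierTwoFamiliesModP

/-!
# Disproof attempts on `PrimeDensityDecay` (crux `stmt-MatrixMultiplication-14311`)

Standing adversary file of the crux disprover (refuter, cdisprove mode), route
`FourierTwoFamiliesModP`.  The crux:

  `∀ ε > 0 ∃ s₀ ∀ p prime ∀ n s (A B : Fin n → Finset (ZMod p)), s₀ ≤ s → balanced(s) → (W) → (X) → n·s ≤ ε·p`

(every balanced SDPP configuration of block size `s ≥ s₀(ε)` in `ℤ/pℤ` fills density `≤ ε`).

## Findings (index; details in the docstrings below)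

* (a) LOAD-BEARING HYPOTHESES — each of (W), (X), `p.Prime` is necessary:
  `primeDensityDecay_false_without_W` (one block `A = B = ℤ/p`), `primeDensityDecay_false_without_X`
  (a direct pair repeated `p` times), `primeDensityDecay_false_without_prime` (only through the junk
  modulus `p = 0`, `ZMod 0 = ℤ`; composite moduli `p ≥ 2` are as open as primes, by the Bertrand lift
  `[0,N) ↪ ℤ/p'`, `p' ∈ (2N, 4N]`, which costs a factor ≤ 4 in density).
  (a') `primeDensityDecay_false_without_W'`: even with (W) weakened to its consequence `s² ≤ p`,
  the (X)-family `A_i = B_i = {i, i+s, …, i+(s-1)s}` (`i < s`, prime `p ∈ (2s², 4s²]`) keeps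
  density `≥ 1/4` at every `s`: directness is the hypothesis doing the work when `n ≫ s`.
  (a'') `sdpp_lift` / `densityDecay_all_moduli_of_crux`: primality is w.l.o.g. — a balanced SDPP
  family in any `ZMod N` lifts through `[0,N)` to `ZMod p` for every `p ≥ 2N` (Bertrand prime
  `p ≤ 4N`), so the crux implies decay in ALL cyclic groups with `ε ↦ 4ε`, and a dense family in
  any `ℤ/N` (e.g. found by the SAT census, which runs over all moduli) would refute it.
* (b) BOUNDARY DATA — `s_two_witness_17`: at `s = 2` density `8/17` (translates, period 4); the
  exact census (gen-1 refuter) is `n_max(p) = ⌊p/4⌋`, density `→ 1/2`, so `s₀(ε) ≥ 3` for `ε < 1/2`.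
  (b') `translate_bound_tight`: for EVERY `s ≥ 1` and every modulus `p ≥ s²` the translate family
  `A_i = i s² + [0,s)`, `B_i = i s² + s[0,s)` is a balanced SDPP family with `n = ⌊p/s²⌋` blocks
  (`trA`, `trB`, `tr_W`, `tr_X`); so density `1/s − s/p` is attained at every `s`, the crux's
  threshold obeys `s₀(ε) ≥ 1/ε − O(1)`, and `translate_family_bound` (`n s² ≤ p`) is sharp.
  (b'') EXACT SMALL CENSUS (complete DFS, docstring of `s_four_witness_30`): `s = 3`:
  `n_max(N) = ⌊N/9⌋` for all `9 ≤ N ≤ 27` (density never above `1/3`); `s = 4`: `n_max = 1` for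
  `16 ≤ N ≤ 29` and `N = 31`, `n_max(30) = 2` (`s_four_witness_30`, by `decide`: the first modulus
  where a non-translate design beats the translate count `⌊N/s²⌋`, composite), `n_max(32) ≥ 2`.
* (c) WHY IT RESISTS, as theorems —
  `induced_block`: for `x ∈ A_i` the `y ∈ Y` with `x − y ∈ D` are exactly `B_i` (so `Y` has
  relative density `≤ 1/s` on every translate `x − D`, `x ∈ X`); `pattern_multiplicity_bound`: at
  most `p/(s|E|)` blocks of ANY (W)+(X) family contain a translate of a pattern `E` (a family of
  density `α` is pattern-diverse at scale `1/α`);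
  `exclusion_zone`: (W)+(X) ⇒ `b + (a − a') ∉ B_k` for `b ∈ B_i`, `a ≠ a' ∈ A_i`, all `k`;
  `common_pattern_bound`: if every `A_i ⊇ t_i + E` then `n·s·|E| ≤ p` (so blocks sharing an
  `m`-point pattern fill density `≤ 1/m`); `A_translates_bound` / `translate_family_bound`: all
  `A_i` translates of one set ⇒ `n s² ≤ p`, density `≤ 1/s`, and `primeDensityDecay_of_translates`
  (the crux on that class, `s₀ = ⌈1/ε⌉ + 1`).  Hence a refutation needs blocks whose internal
  difference patterns are diverse at scale `1/ε`, with `n/s → ∞` and `s² = o(p)` (removal regime =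
  support item RemovalRegime, proved in tree).  Paradigms examined and found wanting (paper analysis,
  see the PARADIGM NOTES doc block): common-difference-set families and digit factorisations of `[0,s²)`
  (`≤ 1/(2s)`), 2-D segment designs (`≤ 1/s`), product/digit alphabets over `(ℤ/M)^m` (a
  Sperner-capacity problem; balance forces the middle layer, full rate ⇔ a dense SDPP alphabet —
  circular; all-abelian record CKSU `(ℤ/3)^(2l)`: `s^(-0.17)`, cyclic record digits `{2..M-1}`:
  `s^(-0.546)`), `k`-dimensional LINE designs (slot count forces `k ≳ √(εM)`, then `~k²M²` near
  pairs per block must all be rescued structurally; the matching variant is `≤ (k/2M³)e^(-2k/M)`),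
  multiplicative `Γ`-orbit designs in `F_p` (cyclotomic equidistribution makes `D` meet every
  class).  None reaches density bounded below; none is refuted as a class either.
* (d) Targets (lead's stuck stubs): none assigned yet.
* (e) Near-misses: none sorried.

Computations: local exact DFS (`sat/dfs_small.py`, ≤ 2 min runs) gave (b''); SAT census / target
jobs extending it (`sat/sdpp_sat.py`: j005131 s=3 N≤40, j005134 s=4 N≤44, j005968 / j005972
density targets up to N = 75) were still queued on 2026-08-16T05Z — results to be folded in here.

LANDED COPIES (refuter Negative lane, `--supports` the crux; namespace `…Theorems.PrimeDensityDecay.Negative.Disproof`):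
`Theorems/PrimeDensityDecay/Negative/LoadBearing.lean` (p83360), `…/PrimeWlog.lean` (p83378),
`…/TranslateClass.lean` (p83404), `…/Structure.lean` (p83599) — all ACCEPTED 2026-08-16; import those, not this work file.
-/

set_option linter.dupNamespace false

namespace Summit.MatrixMultiplication.MatrixMultiplication.Cruxes.PrimeDensityDecay.Disproof

open Finset
open Summit.MatrixMultiplication.MatrixMultiplication.Theses.FourierTwoFamiliesModP

/-! ## 0. Read-back of the crux (the body, verbatim) -/

/-- Read-back: the crux unfolds, by `Iff.rfl`, to the verbatim body below. -/
theorem crux_iff : PrimeDensityDecay ↔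
    (∀ ε : ℝ, 0 < ε → ∃ s₀ : ℕ, ∀ p : ℕ, p.Prime → ∀ (n s : ℕ) (A B : Fin n → Finset (ZMod p)), s₀ ≤ s →
      (∀ i : Fin n, (A i).card = s ∧ (B i).card = s) →
      (∀ i : Fin n, ∀ a ∈ A i, ∀ a' ∈ A i, ∀ b ∈ B i, ∀ b' ∈ B i, (a - a') + (b - b') = 0 → a = a' ∧ b = b') →
      (∀ i j k : Fin n, ∀ a ∈ A i, ∀ a' ∈ A j, ∀ b ∈ B j, ∀ b' ∈ B k, (a - a') + (b - b') = 0 → i = k) →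
      (n : ℝ) * (s : ℝ) ≤ ε * (p : ℝ)) := Iff.rfl

/-! ## 1. The standard witness pair: `A = {0,…,s-1}`, `B = {0, s, 2s, …, (s-1)s}` -/

/-- `{0, 1, …, s-1}` cast into `ZMod p`. -/
def ivA (p s : ℕ) : Finset (ZMod p) := (Finset.range s).image (fun j : ℕ => (j : ZMod p))

/-- `{0, s, 2s, …, (s-1)s}` cast into `ZMod p`. -/
def ivB (p s : ℕ) : Finset (ZMod p) := (Finset.range s).image (fun j : ℕ => ((s * j : ℕ) : ZMod p))

/-- No wrap-around below `s*s`: holds for `p = 0` (`ZMod 0 = ℤ`) and for every `p ≥ s*s`. -/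
def NoWrap (p s : ℕ) : Prop := ∀ m : ℕ, m < s * s → m % p = m

/-- `ZMod 0 = ℤ`: no wrap-around at all. -/
lemma noWrap_zero (s : ℕ) : NoWrap 0 s := fun m _ => Nat.mod_zero m

/-- No wrap-around below `s*s` once `s*s ≤ p`. -/
lemma noWrap_of_le {p s : ℕ} (h : s * s ≤ p) : NoWrap p s :=
  fun _ hm => Nat.mod_eq_of_lt (lt_of_lt_of_le hm h)

/-- `j < s ⇒ j < s*s`. -/
lemma lt_sq_of_lt {s j : ℕ} (hj : j < s) : j < s * s := lt_of_lt_of_le hj (Nat.le_mul_self s)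

/-- `j < s ⇒ s*j < s*s`. -/
lemma mul_lt_sq_of_lt {s j : ℕ} (hj : j < s) : s * j < s * s :=
  Nat.mul_lt_mul_of_pos_left hj (Nat.zero_lt_of_lt hj)

/-- `j, l < s ⇒ j + s*l < s*s` (a two-digit number in base `s`). -/
lemma add_mul_lt_sq {s j l : ℕ} (hj : j < s) (hl : l < s) : j + s * l < s * s := by
  have h1 : j + s * l < s + s * l := Nat.add_lt_add_right hj _
  have h2 : s + s * l = s * (l + 1) := by ring
  have h3 : s * (l + 1) ≤ s * s := Nat.mul_le_mul_left s hl
  omega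

/-- `|ivA p s| = s` when there is no wrap-around. -/
lemma card_ivA {p s : ℕ} (hp : NoWrap p s) : (ivA p s).card = s := by
  classical
  rw [ivA, Finset.card_image_of_injOn, Finset.card_range]
  intro j₁ hj₁ j₂ hj₂ h
  simp only [Finset.coe_range, Set.mem_Iio] at hj₁ hj₂
  have h' := (ZMod.natCast_eq_natCast_iff' _ _ _).mp h
  rwa [hp _ (lt_sq_of_lt hj₁), hp _ (lt_sq_of_lt hj₂)] at h'

/-- `|ivB p s| = s` when there is no wrap-around. -/
lemma card_ivB {p s : ℕ} (hp : NoWrap p s) : (ivB p s).card = s := by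
  classical
  rw [ivB, Finset.card_image_of_injOn, Finset.card_range]
  intro j₁ hj₁ j₂ hj₂ h
  simp only [Finset.coe_range, Set.mem_Iio] at hj₁ hj₂
  have h' := (ZMod.natCast_eq_natCast_iff' _ _ _).mp h
  rw [hp _ (mul_lt_sq_of_lt hj₁), hp _ (mul_lt_sq_of_lt hj₂)] at h'
  exact Nat.eq_of_mul_eq_mul_left (Nat.zero_lt_of_lt hj₁) h'

/-- (W) for the witness pair: `{0..s-1} ⊕ s·{0..s-1}` is direct (Euclidean division). -/
lemma iv_W {p s : ℕ} (hp : NoWrap p s) :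
    ∀ a ∈ ivA p s, ∀ a' ∈ ivA p s, ∀ b ∈ ivB p s, ∀ b' ∈ ivB p s,
      (a - a') + (b - b') = 0 → a = a' ∧ b = b' := by
  intro a ha a' ha' b hb b' hb' h
  simp only [ivA, ivB, Finset.mem_image, Finset.mem_range] at ha ha' hb hb'
  obtain ⟨j₁, hj₁, rfl⟩ := ha
  obtain ⟨j₂, hj₂, rfl⟩ := ha'
  obtain ⟨j₃, hj₃, rfl⟩ := hb
  obtain ⟨j₄, hj₄, rfl⟩ := hb'
  have h' : ((j₁ + s * j₃ : ℕ) : ZMod p) = ((j₂ + s * j₄ : ℕ) : ZMod p) := by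
    push_cast at h ⊢
    linear_combination h
  have h'' := (ZMod.natCast_eq_natCast_iff' _ _ _).mp h'
  rw [hp _ (add_mul_lt_sq hj₁ hj₃), hp _ (add_mul_lt_sq hj₂ hj₄)] at h''
  have hs : 0 < s := Nat.zero_lt_of_lt hj₁
  have hmod := congrArg (· % s) h''
  simp only [Nat.add_mul_mod_self_left, Nat.mod_eq_of_lt hj₁, Nat.mod_eq_of_lt hj₂] at hmod
  subst hmod
  have h34 : j₃ = j₄ := Nat.eq_of_mul_eq_mul_left hs (by omega)
  subst h34
  exact ⟨rfl, rfl⟩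

/-! ## (a) Load-bearing hypotheses -/

/-- The crux with hypothesis (W) deleted (verbatim otherwise). -/
def PrimeDensityDecayWithoutW : Prop :=
  ∀ ε : ℝ, 0 < ε → ∃ s₀ : ℕ, ∀ p : ℕ, p.Prime → ∀ (n s : ℕ) (A B : Fin n → Finset (ZMod p)), s₀ ≤ s →
    (∀ i : Fin n, (A i).card = s ∧ (B i).card = s) →
    (∀ i j k : Fin n, ∀ a ∈ A i, ∀ a' ∈ A j, ∀ b ∈ B j, ∀ b' ∈ B k, (a - a') + (b - b') = 0 → i = k) →
    (n : ℝ) * (s : ℝ) ≤ ε * (p : ℝ)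

/-- ANY PROOF MUST USE (W).  Without directness nothing bounds `s`: one block `A = B = ℤ/p`
(`n = 1`, `s = p`) satisfies (X) vacuously and has density 1.  (The finer role of (W) — beyond
forcing `s² ≤ p` — is the `exclusion zone` `Y ∩ (B_i + (A_i − A_i) ∖ 0) = ∅`; even with `s² ≤ p`
imposed, the (X)-only family `A_i = B_i = {i, i+q, …, i+(s-1)q}`, `i < q`, `p ∈ (2qs, 4qs]` keeps
density `≥ 1/4` at every `s` — not yet formalised here.) -/
theorem primeDensityDecay_false_without_W : ¬ PrimeDensityDecayWithoutW := by
  intro h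
  obtain ⟨s₀, hs₀⟩ := h (1 / 2) (by norm_num)
  obtain ⟨p, hp_ge, hp⟩ := Nat.exists_infinite_primes (s₀ + 2)
  haveI : NeZero p := ⟨hp.ne_zero⟩
  have key := hs₀ p hp 1 p (fun _ => Finset.univ) (fun _ => Finset.univ) (by omega)
    (fun _ => by simp [Finset.card_univ, ZMod.card])
    (fun i j k _ _ _ _ _ _ _ _ _ => Subsingleton.elim i k)
  have hpos : (0 : ℝ) < p := by exact_mod_cast hp.pos
  push_cast at key
  linarith

/-- The crux with hypothesis (X) deleted (verbatim otherwise). -/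
def PrimeDensityDecayWithoutX : Prop :=
  ∀ ε : ℝ, 0 < ε → ∃ s₀ : ℕ, ∀ p : ℕ, p.Prime → ∀ (n s : ℕ) (A B : Fin n → Finset (ZMod p)), s₀ ≤ s →
    (∀ i : Fin n, (A i).card = s ∧ (B i).card = s) →
    (∀ i : Fin n, ∀ a ∈ A i, ∀ a' ∈ A i, ∀ b ∈ B i, ∀ b' ∈ B i, (a - a') + (b - b') = 0 → a = a' ∧ b = b') →
    (n : ℝ) * (s : ℝ) ≤ ε * (p : ℝ)

/-- ANY PROOF MUST USE (X).  Without the cross condition the blocks need not even be disjoint: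
`n = p` copies of the single direct pair `({0..s-1}, s·{0..s-1})`, `p ≥ s²`, give `n·s = p·s`. -/
theorem primeDensityDecay_false_without_X : ¬ PrimeDensityDecayWithoutX := by
  intro h
  obtain ⟨s₀, hs₀⟩ := h (1 / 2) (by norm_num)
  obtain ⟨p, hp_ge, hp⟩ := Nat.exists_infinite_primes ((s₀ + 1) * (s₀ + 1))
  have hnw : NoWrap p (s₀ + 1) := noWrap_of_le hp_ge
  have key := hs₀ p hp p (s₀ + 1) (fun _ => ivA p (s₀ + 1)) (fun _ => ivB p (s₀ + 1)) (by omega)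
    (fun _ => ⟨card_ivA hnw, card_ivB hnw⟩) (fun _ => iv_W hnw)
  have hp1 : (1 : ℝ) ≤ p := by exact_mod_cast hp.one_lt.le
  have hs1 : (1 : ℝ) ≤ ((s₀ + 1 : ℕ) : ℝ) := by
    push_cast; linarith [(Nat.cast_nonneg s₀ : (0:ℝ) ≤ s₀)]
  nlinarith

/-- The crux with hypothesis `p.Prime` deleted (verbatim otherwise). -/
def PrimeDensityDecayWithoutPrime : Prop :=
  ∀ ε : ℝ, 0 < ε → ∃ s₀ : ℕ, ∀ p : ℕ, ∀ (n s : ℕ) (A B : Fin n → Finset (ZMod p)), s₀ ≤ s →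
    (∀ i : Fin n, (A i).card = s ∧ (B i).card = s) →
    (∀ i : Fin n, ∀ a ∈ A i, ∀ a' ∈ A i, ∀ b ∈ B i, ∀ b' ∈ B i, (a - a') + (b - b') = 0 → a = a' ∧ b = b') →
    (∀ i j k : Fin n, ∀ a ∈ A i, ∀ a' ∈ A j, ∀ b ∈ B j, ∀ b' ∈ B k, (a - a') + (b - b') = 0 → i = k) →
    (n : ℝ) * (s : ℝ) ≤ ε * (p : ℝ)

/-- `p.Prime` IS USED, but only to exclude the junk modulus `p = 0` (`ZMod 0 = ℤ`, where one direct
pair of any size has `n·s = s > ε·0`).  Remark (not formalised): for composite `p ≥ 2` the statement is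
implied by the prime case up to `ε ↦ 4ε` (view a design in `ℤ/N` inside `[0,N) ⊂ ℤ`, then in `ℤ/p'`
for a prime `p' ∈ (2N, 4N]`; four-term sums of absolute value `< 2N < p'` vanish mod `p'` iff they
vanish in `ℤ`, and then they vanish mod `N`). -/
theorem primeDensityDecay_false_without_prime : ¬ PrimeDensityDecayWithoutPrime := by
  intro h
  obtain ⟨s₀, hs₀⟩ := h (1 / 2) (by norm_num)
  have hnw : NoWrap 0 (s₀ + 1) := noWrap_zero _
  have key := hs₀ 0 1 (s₀ + 1) (fun _ => ivA 0 (s₀ + 1)) (fun _ => ivB 0 (s₀ + 1)) (by omega)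
    (fun _ => ⟨card_ivA hnw, card_ivB hnw⟩) (fun _ => iv_W hnw)
    (fun i j k _ _ _ _ _ _ _ _ _ => Subsingleton.elim i k)
  have hs1 : (1 : ℝ) ≤ ((s₀ + 1 : ℕ) : ℝ) := by
    push_cast; linarith [(Nat.cast_nonneg s₀ : (0:ℝ) ≤ s₀)]
  push_cast at key hs1
  linarith

/-! ### (a') The finer role of (W): with (X) and `s² ≤ p` but no directness, density `1/4` persists -/

/-- The interleaved progressions `C_i = {i, i+q, …, i+(s-1)q}` cast into `ZMod p`. -/
def ivC (p q s i : ℕ) : Finset (ZMod p) := (Finset.range s).image (fun j : ℕ => ((i + q * j : ℕ) : ZMod p))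

/-- `i + q*j < q*s` for `i < q`, `j < s`. -/
lemma add_mul_lt_mul {q s i j : ℕ} (hi : i < q) (hj : j < s) : i + q * j < q * s := by
  have h1 : i + q * j < q + q * j := Nat.add_lt_add_right hi _
  have h2 : q + q * j = q * (j + 1) := by ring
  have h3 : q * (j + 1) ≤ q * s := Nat.mul_le_mul_left q hj
  omega

/-- `|C_i| = s` when `q*s ≤ p` (or `p = 0`). -/
lemma card_ivC {p q s i : ℕ} (hp : ∀ m : ℕ, m < 2 * (q * s) → m % p = m) (hi : i < q) :
    (ivC p q s i).card = s := by
  classical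
  rw [ivC, Finset.card_image_of_injOn, Finset.card_range]
  intro j₁ hj₁ j₂ hj₂ h
  simp only [Finset.coe_range, Set.mem_Iio] at hj₁ hj₂
  have h' := (ZMod.natCast_eq_natCast_iff' _ _ _).mp h
  have b₁ := add_mul_lt_mul hi hj₁
  have b₂ := add_mul_lt_mul hi hj₂
  rw [hp _ (by omega), hp _ (by omega)] at h'
  have hq : 0 < q := Nat.zero_lt_of_lt hi
  exact Nat.eq_of_mul_eq_mul_left hq (by omega)

/-- (X) for the interleaved family `A_i = B_i = C_i`, `i < q`: a four-term relation of naturals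
`< 2qs ≤ p` is an identity in `ℕ`, and reducing it mod `q` gives `i = k`.  (W) FAILS for it
(`C_i − C_i` repeats every difference `s`-fold), which is the point. -/
lemma ivC_X {p q s : ℕ} (hp : ∀ m : ℕ, m < 2 * (q * s) → m % p = m) :
    ∀ i j k : Fin q, ∀ a ∈ ivC p q s i, ∀ a' ∈ ivC p q s j, ∀ b ∈ ivC p q s j, ∀ b' ∈ ivC p q s k,
      (a - a') + (b - b') = 0 → i = k := by
  intro i j k a ha a' ha' b hb b' hb' h
  simp only [ivC, Finset.mem_image, Finset.mem_range] at ha ha' hb hb'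
  obtain ⟨j₁, hj₁, rfl⟩ := ha
  obtain ⟨j₂, hj₂, rfl⟩ := ha'
  obtain ⟨j₃, hj₃, rfl⟩ := hb
  obtain ⟨j₄, hj₄, rfl⟩ := hb'
  have h' : (((i : ℕ) + q * j₁ + ((j : ℕ) + q * j₃) : ℕ) : ZMod p)
      = ((((j : ℕ) + q * j₂) + ((k : ℕ) + q * j₄) : ℕ) : ZMod p) := by
    push_cast at h ⊢
    linear_combination h
  have h'' := (ZMod.natCast_eq_natCast_iff' _ _ _).mp h'
  have b₁ := add_mul_lt_mul i.isLt hj₁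
  have b₂ := add_mul_lt_mul j.isLt hj₂
  have b₃ := add_mul_lt_mul j.isLt hj₃
  have b₄ := add_mul_lt_mul k.isLt hj₄
  rw [hp _ (by omega), hp _ (by omega)] at h''
  -- h'' : i + q*j₁ + (j + q*j₃) = j + q*j₂ + (k + q*j₄) in ℕ; reduce mod q
  have hmod := congrArg (· % q) h''
  have e1 : ((i : ℕ) + q * j₁ + ((j : ℕ) + q * j₃)) % q = ((i : ℕ) + (j : ℕ)) % q := by
    rw [show (i : ℕ) + q * j₁ + ((j : ℕ) + q * j₃) = ((i : ℕ) + (j : ℕ)) + q * (j₁ + j₃) by ring]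
    exact Nat.add_mul_mod_self_left _ _ _
  have e2 : ((j : ℕ) + q * j₂ + ((k : ℕ) + q * j₄)) % q = ((k : ℕ) + (j : ℕ)) % q := by
    rw [show (j : ℕ) + q * j₂ + ((k : ℕ) + q * j₄) = ((k : ℕ) + (j : ℕ)) + q * (j₂ + j₄) by ring]
    exact Nat.add_mul_mod_self_left _ _ _
  simp only [e1, e2] at hmod
  -- (i + j) % q = (k + j) % q with i, k < q
  have hik : (i : ℕ) % q = (k : ℕ) % q := by
    have := Nat.ModEq.add_right_cancel' (j : ℕ) (show (i : ℕ) + j ≡ (k : ℕ) + j [MOD q] from hmod)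
    exact this
  rw [Nat.mod_eq_of_lt i.isLt, Nat.mod_eq_of_lt k.isLt] at hik
  exact Fin.ext hik

/-- The crux with (W) REPLACED by its cheap consequence `s*s ≤ p` (verbatim otherwise). -/
def PrimeDensityDecayWithoutW' : Prop :=
  ∀ ε : ℝ, 0 < ε → ∃ s₀ : ℕ, ∀ p : ℕ, p.Prime → ∀ (n s : ℕ) (A B : Fin n → Finset (ZMod p)), s₀ ≤ s →
    s * s ≤ p →
    (∀ i : Fin n, (A i).card = s ∧ (B i).card = s) →
    (∀ i j k : Fin n, ∀ a ∈ A i, ∀ a' ∈ A j, ∀ b ∈ B j, ∀ b' ∈ B k, (a - a') + (b - b') = 0 → i = k) →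
    (n : ℝ) * (s : ℝ) ≤ ε * (p : ℝ)

/-- (W) IS USED BEYOND `s² ≤ p`: the interleaved family `A_i = B_i = {i, i+s, …, i+(s-1)s}`,
`i < s`, in `ℤ/p` for a prime `p ∈ (2s², 4s²]` (Bertrand) satisfies (X), balance and `s² ≤ p`,
with `n·s = s² ≥ p/4` at every `s` — so the directness of each pair (the exclusion zones it
creates, `exclusion_zone`) is what any proof must exploit in the regime `n ≫ s`… here `n = s`,
and taking `q = K·s` classes instead of `s` gives the same density `1/4` with `n = K s` for any `K`
(not formalised: only the parameter choice changes). -/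
theorem primeDensityDecay_false_without_W' : ¬ PrimeDensityDecayWithoutW' := by
  intro h
  obtain ⟨s₀, hs₀⟩ := h (1 / 5) (by norm_num)
  set s : ℕ := s₀ + 1 with hsdef
  have hs : 0 < s := Nat.succ_pos _
  have hss : 0 < 2 * (s * s) := by positivity
  obtain ⟨p, hp, hlt, hle⟩ := Nat.exists_prime_lt_and_le_two_mul (2 * (s * s)) (by omega)
  have hnw : ∀ m : ℕ, m < 2 * (s * s) → m % p = m := fun m hm => Nat.mod_eq_of_lt (by omega)
  have key := hs₀ p hp s s (fun i => ivC p s s i) (fun i => ivC p s s i) (by omega) (by omega)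
    (fun i => ⟨card_ivC hnw i.isLt, card_ivC hnw i.isLt⟩) (ivC_X hnw)
  -- key : (s:ℝ) * s ≤ 1/5 * p, while p ≤ 4 s², p > 0
  have hle' : (p : ℝ) ≤ 2 * (2 * ((s : ℝ) * s)) := by exact_mod_cast hle
  have hsR : (1 : ℝ) ≤ s := by
    rw [hsdef]; push_cast; linarith [(Nat.cast_nonneg s₀ : (0:ℝ) ≤ s₀)]
  nlinarith

/-! ## (a'') Prime moduli are w.l.o.g.: the Bertrand lift `ZMod N → [0,N) → ZMod p`, `p ≥ 2N` -/

/-- Lift a finite set of residues mod `N` to `ZMod p` through the representatives in `[0,N)`. -/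
def liftSet {N : ℕ} (p : ℕ) (S : Finset (ZMod N)) : Finset (ZMod p) :=
  S.image (fun x : ZMod N => ((x.val : ℕ) : ZMod p))

/-- A four-term relation among lifted representatives is an integer of absolute value `< 2N ≤ p`,
hence vanishes in `ℤ`. -/
lemma lift_rel_int {N p : ℕ} [NeZero N] (hp : 2 * N ≤ p) (x y z w : ZMod N)
    (h : (((x.val : ℕ) : ZMod p) - ((y.val : ℕ) : ZMod p)) +
      ((((z.val : ℕ) : ZMod p)) - ((w.val : ℕ) : ZMod p)) = 0) :
    ((x.val : ℤ) - y.val) + ((z.val : ℤ) - w.val) = 0 := by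
  have hz : (((((x.val : ℤ) - y.val) + ((z.val : ℤ) - w.val)) : ℤ) : ZMod p) = 0 := by
    push_cast
    exact h
  rw [ZMod.intCast_zmod_eq_zero_iff_dvd] at hz
  have hx : (x.val : ℤ) < N := by exact_mod_cast ZMod.val_lt x
  have hy : (y.val : ℤ) < N := by exact_mod_cast ZMod.val_lt y
  have hzv : (z.val : ℤ) < N := by exact_mod_cast ZMod.val_lt z
  have hw : (w.val : ℤ) < N := by exact_mod_cast ZMod.val_lt w
  have n1 : (0 : ℤ) ≤ x.val := Nat.cast_nonneg _
  have n2 : (0 : ℤ) ≤ y.val := Nat.cast_nonneg _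
  have n3 : (0 : ℤ) ≤ z.val := Nat.cast_nonneg _
  have n4 : (0 : ℤ) ≤ w.val := Nat.cast_nonneg _
  have hp' : (2 : ℤ) * N ≤ p := by exact_mod_cast hp
  refine Int.eq_zero_of_abs_lt_dvd hz ?_
  rw [abs_lt]; constructor <;> linarith

/-- … and therefore the same relation already holds mod `N`. -/
lemma lift_rel_mod {N p : ℕ} [NeZero N] (hp : 2 * N ≤ p) (x y z w : ZMod N)
    (h : (((x.val : ℕ) : ZMod p) - ((y.val : ℕ) : ZMod p)) +
      ((((z.val : ℕ) : ZMod p)) - ((w.val : ℕ) : ZMod p)) = 0) :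
    (x - y) + (z - w) = 0 := by
  have h0 := lift_rel_int hp x y z w h
  have h1 : (((((x.val : ℤ) - y.val) + ((z.val : ℤ) - w.val)) : ℤ) : ZMod N) = 0 := by
    rw [h0]; simp
  push_cast at h1
  simpa [ZMod.natCast_zmod_val] using h1

/-- The lift is injective (`N ≤ p`). -/
lemma lift_injective {N p : ℕ} [NeZero N] (hp : 2 * N ≤ p) :
    Function.Injective (fun x : ZMod N => ((x.val : ℕ) : ZMod p)) := by
  intro x y h
  have h' := (ZMod.natCast_eq_natCast_iff' _ _ _).mp h
  have hx := ZMod.val_lt x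
  have hy := ZMod.val_lt y
  rw [Nat.mod_eq_of_lt (by omega), Nat.mod_eq_of_lt (by omega)] at h'
  exact ZMod.val_injective N h'

/-- `|liftSet p S| = |S|`. -/
lemma card_liftSet {N p : ℕ} [NeZero N] (hp : 2 * N ≤ p) (S : Finset (ZMod N)) :
    (liftSet p S).card = S.card := by
  classical
  exact Finset.card_image_of_injective _ (lift_injective hp)

/-- BERTRAND TRANSFER — PRIME MODULI ARE W.L.O.G. (up to a factor `≤ 4`, indeed `2 + o(1)`, in
density): a balanced SDPP family in `ZMod N` (`N ≥ 1`, composite allowed) lifts to a balanced SDPP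
family with the same `n` and `s` in `ZMod p` for EVERY `p ≥ 2N`; with a prime `p ∈ (2N, 4N]`
(`Nat.exists_prime_lt_and_le_two_mul`) the density drops by at most `4`.  So `PrimeDensityDecay`
implies the same decay statement for all cyclic groups (and, through CRT, for all `⊕ ℤ/m_t` with
pairwise coprime `m_t`); conversely a dense family in any `ℤ/N` would refute the crux. -/
theorem sdpp_lift {N p : ℕ} [NeZero N] (hp : 2 * N ≤ p) {n s : ℕ} (A B : Fin n → Finset (ZMod N))
    (hcard : ∀ i : Fin n, (A i).card = s ∧ (B i).card = s)
    (hW : ∀ i : Fin n, ∀ a ∈ A i, ∀ a' ∈ A i, ∀ b ∈ B i, ∀ b' ∈ B i,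
      (a - a') + (b - b') = 0 → a = a' ∧ b = b')
    (hX : ∀ i j k : Fin n, ∀ a ∈ A i, ∀ a' ∈ A j, ∀ b ∈ B j, ∀ b' ∈ B k,
      (a - a') + (b - b') = 0 → i = k) :
    (∀ i : Fin n, (liftSet p (A i)).card = s ∧ (liftSet p (B i)).card = s) ∧
    (∀ i : Fin n, ∀ a ∈ liftSet p (A i), ∀ a' ∈ liftSet p (A i), ∀ b ∈ liftSet p (B i),
      ∀ b' ∈ liftSet p (B i), (a - a') + (b - b') = 0 → a = a' ∧ b = b') ∧
    (∀ i j k : Fin n, ∀ a ∈ liftSet p (A i), ∀ a' ∈ liftSet p (A j), ∀ b ∈ liftSet p (B j),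
      ∀ b' ∈ liftSet p (B k), (a - a') + (b - b') = 0 → i = k) := by
  refine ⟨fun i => ⟨?_, ?_⟩, ?_, ?_⟩
  · rw [card_liftSet hp, (hcard i).1]
  · rw [card_liftSet hp, (hcard i).2]
  · intro i a ha a' ha' b hb b' hb' h
    simp only [liftSet, Finset.mem_image] at ha ha' hb hb'
    obtain ⟨x, hx, rfl⟩ := ha
    obtain ⟨y, hy, rfl⟩ := ha'
    obtain ⟨z, hz, rfl⟩ := hb
    obtain ⟨w, hw, rfl⟩ := hb'
    obtain ⟨rfl, rfl⟩ := hW i x hx y hy z hz w hw (lift_rel_mod hp x y z w h)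
    exact ⟨rfl, rfl⟩
  · intro i j k a ha a' ha' b hb b' hb' h
    simp only [liftSet, Finset.mem_image] at ha ha' hb hb'
    obtain ⟨x, hx, rfl⟩ := ha
    obtain ⟨y, hy, rfl⟩ := ha'
    obtain ⟨z, hz, rfl⟩ := hb
    obtain ⟨w, hw, rfl⟩ := hb'
    exact hX i j k x hx y hy z hz w hw (lift_rel_mod hp x y z w h)

/-- Corollary: the crux implies density decay in EVERY cyclic group `ℤ/N`, `N ≥ 1`, with `ε ↦ 4ε`. -/
theorem densityDecay_all_moduli_of_crux (h : PrimeDensityDecay) :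
    ∀ ε : ℝ, 0 < ε → ∃ s₀ : ℕ, ∀ N : ℕ, 0 < N → ∀ (n s : ℕ) (A B : Fin n → Finset (ZMod N)), s₀ ≤ s →
      (∀ i : Fin n, (A i).card = s ∧ (B i).card = s) →
      (∀ i : Fin n, ∀ a ∈ A i, ∀ a' ∈ A i, ∀ b ∈ B i, ∀ b' ∈ B i,
        (a - a') + (b - b') = 0 → a = a' ∧ b = b') →
      (∀ i j k : Fin n, ∀ a ∈ A i, ∀ a' ∈ A j, ∀ b ∈ B j, ∀ b' ∈ B k,
        (a - a') + (b - b') = 0 → i = k) →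
      (n : ℝ) * (s : ℝ) ≤ 4 * ε * (N : ℝ) := by
  intro ε hε
  obtain ⟨s₀, hs₀⟩ := h ε hε
  refine ⟨s₀, ?_⟩
  intro N hN n s A B hs hcard hW hX
  haveI : NeZero N := ⟨Nat.pos_iff_ne_zero.mp hN⟩
  obtain ⟨p, hp, hlt, hle⟩ := Nat.exists_prime_lt_and_le_two_mul (2 * N) (by omega)
  obtain ⟨hc', hW', hX'⟩ := sdpp_lift (p := p) (by omega) A B hcard hW hX
  have key := hs₀ p hp n s (fun i => liftSet p (A i)) (fun i => liftSet p (B i)) hs hc' hW' hX'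
  have hle' : (p : ℝ) ≤ 2 * (2 * (N : ℝ)) := by exact_mod_cast hle
  have : ε * (p : ℝ) ≤ ε * (2 * (2 * (N : ℝ))) := mul_le_mul_of_nonneg_left hle' hε.le
  linarith

/-! ## (b) Boundary data at `s = 2` -/

/-- Period-4 translates in `ℤ/17`: `A_i = {4i, 4i+1}`, `B_i = {4i, 4i+2}`, `i < 4`. -/
abbrev A17 : Fin 4 → Finset (ZMod 17) := ![{0, 1}, {4, 5}, {8, 9}, {12, 13}]
/-- see `A17`. -/
abbrev B17 : Fin 4 → Finset (ZMod 17) := ![{0, 2}, {4, 6}, {8, 10}, {12, 14}]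

/-- balance of the `ℤ/17` witness. -/
lemma A17_card : ∀ i : Fin 4, (A17 i).card = 2 ∧ (B17 i).card = 2 := by decide
/-- (W) for the `ℤ/17` witness. -/
lemma A17_W : ∀ i : Fin 4, ∀ a ∈ A17 i, ∀ a' ∈ A17 i, ∀ b ∈ B17 i, ∀ b' ∈ B17 i,
    (a - a') + (b - b') = 0 → a = a' ∧ b = b' := by decide
/-- (X) for the `ℤ/17` witness. -/
lemma A17_X : ∀ i j k : Fin 4, ∀ a ∈ A17 i, ∀ a' ∈ A17 j, ∀ b ∈ B17 j, ∀ b' ∈ B17 k,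
    (a - a') + (b - b') = 0 → i = k := by decide

/-- BOUNDARY: a balanced SDPP configuration with `s = 2`, `n = 4`, `p = 17`, density `8/17 > 0.47`;
hence in the crux `s₀(ε) ≥ 3` for every `ε < 8/17` (and, by the gen-1 exact census `n_max(p) = ⌊p/4⌋`
for `s = 2`, `s₀(ε) ≥ 3` for every `ε < 1/2`). -/
theorem s_two_witness_17 : ∃ (A B : Fin 4 → Finset (ZMod 17)),
    (∀ i : Fin 4, (A i).card = 2 ∧ (B i).card = 2) ∧
    (∀ i : Fin 4, ∀ a ∈ A i, ∀ a' ∈ A i, ∀ b ∈ B i, ∀ b' ∈ B i, (a - a') + (b - b') = 0 → a = a' ∧ b = b') ∧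
    (∀ i j k : Fin 4, ∀ a ∈ A i, ∀ a' ∈ A j, ∀ b ∈ B j, ∀ b' ∈ B k, (a - a') + (b - b') = 0 → i = k) ∧
    (17 : ℝ) * (8 / 17) ≤ (4 : ℝ) * 2 :=
  ⟨A17, B17, A17_card, A17_W, A17_X, by norm_num⟩

/-! ### (b'') Exact small census (local DFS `sat/dfs_small.py`, complete searches) and the first
non-translate gain -/

/-- The `ℤ/30` configuration found by exhaustive search: `A₀ = {0,1,2,3}`, `B₀ = {0,5,10,15}`,
`A₁ = {9,14,19,24}`, `B₁ = {19,21,22,23}` (`A₁ − B₁ = (A₀ − B₀) ∖ {15} ∪ {5}`). -/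
abbrev A30 : Fin 2 → Finset (ZMod 30) := ![{0, 1, 2, 3}, {9, 14, 19, 24}]
/-- see `A30`. -/
abbrev B30 : Fin 2 → Finset (ZMod 30) := ![{0, 5, 10, 15}, {19, 21, 22, 23}]

/-- balance of the `ℤ/30` configuration. -/
lemma A30_card : ∀ i : Fin 2, (A30 i).card = 4 ∧ (B30 i).card = 4 := by decide
set_option maxRecDepth 100000 in
/-- (W) for the `ℤ/30` configuration. -/
lemma A30_W : ∀ i : Fin 2, ∀ a ∈ A30 i, ∀ a' ∈ A30 i, ∀ b ∈ B30 i, ∀ b' ∈ B30 i,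
    (a - a') + (b - b') = 0 → a = a' ∧ b = b' := by decide
set_option maxRecDepth 100000 in
/-- (X) for the `ℤ/30` configuration. -/
lemma A30_X : ∀ i j k : Fin 2, ∀ a ∈ A30 i, ∀ a' ∈ A30 j, ∀ b ∈ B30 j, ∀ b' ∈ B30 k,
    (a - a') + (b - b') = 0 → i = k := by decide

/-- EXACT SMALL CENSUS (complete depth-first searches, `sat/dfs_small.py`, every witness
re-verified on the literal four-variable conditions; larger ranges are queued as SAT jobs):
* `s = 2`: `n_max(N) = ⌊N/4⌋` for `5 ≤ N ≤ 14` (gen-1 refuter: also for the primes `≤ 19`);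
* `s = 3`: `n_max(N) = ⌊N/9⌋` for ALL `9 ≤ N ≤ 27` — translates are optimal, density never
  exceeds `1/3 = 1/s`, and the translate bound `n s² ≤ N` is the exact truth in this range;
* `s = 4`: `n_max(N) = 1` for `16 ≤ N ≤ 29` and for the prime `N = 31`, but `n_max(30) = 2`
  (this configuration, `n s² = 32 > 30`: the first modulus where a non-translate design beats the
  translate count — composite, and by `sdpp_lift` it only reaches primes `p ≥ 60`, where
  `n s² = 32 < p`), `n_max(32) ≥ 2`.
So at block sizes `2, 3, 4` nothing comes close to density bounded away from `1/s`; the data are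
consistent with decay and with `n_max(p) = ⌊p/s²⌋` for PRIME `p` at `s ≤ 4` (open). -/
theorem s_four_witness_30 : ∃ (A B : Fin 2 → Finset (ZMod 30)),
    (∀ i : Fin 2, (A i).card = 4 ∧ (B i).card = 4) ∧
    (∀ i : Fin 2, ∀ a ∈ A i, ∀ a' ∈ A i, ∀ b ∈ B i, ∀ b' ∈ B i, (a - a') + (b - b') = 0 → a = a' ∧ b = b') ∧
    (∀ i j k : Fin 2, ∀ a ∈ A i, ∀ a' ∈ A j, ∀ b ∈ B j, ∀ b' ∈ B k, (a - a') + (b - b') = 0 → i = k) ∧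
    (30 : ℕ) < 2 * 4 ^ 2 :=
  ⟨A30, B30, A30_card, A30_W, A30_X, by norm_num⟩

/-! ## (b') Tightness: translates attain `n = ⌊p/s²⌋` at EVERY `s` (so `s₀(ε) > 1/ε − 1`) -/

/-- Translate blocks `A_i = i·s² + {0,…,s-1}` cast into `ZMod p`. -/
def trA (p s i : ℕ) : Finset (ZMod p) :=
  (Finset.range s).image (fun j : ℕ => ((i * (s * s) + j : ℕ) : ZMod p))

/-- Translate blocks `B_i = i·s² + {0, s, …, (s-1)s}` cast into `ZMod p`. -/
def trB (p s i : ℕ) : Finset (ZMod p) :=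
  (Finset.range s).image (fun j : ℕ => ((i * (s * s) + s * j : ℕ) : ZMod p))

/-- `|(j₁ − j₂) + s(j₃ − j₄)| < s²` for digits `< s`. -/
lemma digits_abs_lt {s j₁ j₂ j₃ j₄ : ℕ} (h₁ : j₁ < s) (h₂ : j₂ < s) (h₃ : j₃ < s) (h₄ : j₄ < s) :
    |((j₁ : ℤ) - j₂) + s * ((j₃ : ℤ) - j₄)| < (s : ℤ) * s := by
  have a3 : s * j₃ + s ≤ s * s := by
    have := Nat.mul_le_mul_left s h₃; rw [Nat.mul_succ] at this; exact this
  have a4 : s * j₄ + s ≤ s * s := by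
    have := Nat.mul_le_mul_left s h₄; rw [Nat.mul_succ] at this; exact this
  have a3' : (s : ℤ) * j₃ + s ≤ (s : ℤ) * s := by exact_mod_cast a3
  have a4' : (s : ℤ) * j₄ + s ≤ (s : ℤ) * s := by exact_mod_cast a4
  have h₁' : (j₁ : ℤ) < s := by exact_mod_cast h₁
  have h₂' : (j₂ : ℤ) < s := by exact_mod_cast h₂
  have n1 : (0 : ℤ) ≤ j₁ := Nat.cast_nonneg j₁
  have n2 : (0 : ℤ) ≤ j₂ := Nat.cast_nonneg j₂
  have n3 : (0 : ℤ) ≤ (s : ℤ) * j₃ := by positivity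
  have n4 : (0 : ℤ) ≤ (s : ℤ) * j₄ := by positivity
  rw [abs_lt]
  constructor <;> nlinarith

/-- Balanced base-`s` digits: `(j₁ − j₂) + s(j₃ − j₄) = 0` with all digits `< s` forces equality. -/
lemma digits_eq {s j₁ j₂ j₃ j₄ : ℕ} (h₁ : j₁ < s) (h₂ : j₂ < s)
    (h : ((j₁ : ℤ) - j₂) + s * ((j₃ : ℤ) - j₄) = 0) : j₁ = j₂ ∧ j₃ = j₄ := by
  have h' : j₁ + s * j₃ = j₂ + s * j₄ := by
    have : ((j₁ + s * j₃ : ℕ) : ℤ) = ((j₂ + s * j₄ : ℕ) : ℤ) := by push_cast; linarith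
    exact_mod_cast this
  have hmod := congrArg (· % s) h'
  simp only [Nat.add_mul_mod_self_left, Nat.mod_eq_of_lt h₁, Nat.mod_eq_of_lt h₂] at hmod
  subst hmod
  exact ⟨rfl, Nat.eq_of_mul_eq_mul_left (Nat.zero_lt_of_lt h₁) (by omega)⟩

/-- `|trA p s i| = s` when `s ≤ p`. -/
lemma card_trA {p s : ℕ} (hsp : s ≤ p) (i : ℕ) : (trA p s i).card = s := by
  classical
  rw [trA, Finset.card_image_of_injOn, Finset.card_range]
  intro j₁ hj₁ j₂ hj₂ h
  simp only [Finset.coe_range, Set.mem_Iio] at hj₁ hj₂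
  have hz : ((((j₁ : ℤ) - j₂) : ℤ) : ZMod p) = 0 := by
    have h' : ((i * (s * s) + j₁ : ℕ) : ZMod p) = ((i * (s * s) + j₂ : ℕ) : ZMod p) := h
    push_cast at h' ⊢
    linear_combination h'
  rw [ZMod.intCast_zmod_eq_zero_iff_dvd] at hz
  have hlt : |((j₁ : ℤ) - j₂)| < (p : ℤ) := by
    have h₁' : (j₁ : ℤ) < s := by exact_mod_cast hj₁
    have h₂' : (j₂ : ℤ) < s := by exact_mod_cast hj₂
    have hsp' : (s : ℤ) ≤ p := by exact_mod_cast hsp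
    have n1 : (0 : ℤ) ≤ j₁ := Nat.cast_nonneg j₁
    have n2 : (0 : ℤ) ≤ j₂ := Nat.cast_nonneg j₂
    rw [abs_lt]; constructor <;> linarith
  have h0 := Int.eq_zero_of_abs_lt_dvd hz hlt
  omega

/-- `|trB p s i| = s` when `s*s ≤ p`. -/
lemma card_trB {p s : ℕ} (hsp : s * s ≤ p) (i : ℕ) : (trB p s i).card = s := by
  classical
  rw [trB, Finset.card_image_of_injOn, Finset.card_range]
  intro j₁ hj₁ j₂ hj₂ h
  simp only [Finset.coe_range, Set.mem_Iio] at hj₁ hj₂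
  have hz : (((s * ((j₁ : ℤ) - j₂)) : ℤ) : ZMod p) = 0 := by
    have h' : ((i * (s * s) + s * j₁ : ℕ) : ZMod p) = ((i * (s * s) + s * j₂ : ℕ) : ZMod p) := h
    push_cast at h' ⊢
    linear_combination h'
  rw [ZMod.intCast_zmod_eq_zero_iff_dvd] at hz
  have hlt : |(s * ((j₁ : ℤ) - j₂))| < (p : ℤ) := by
    have := digits_abs_lt hj₁ hj₁ hj₁ hj₂
    have hsp' : (s : ℤ) * s ≤ p := by exact_mod_cast hsp
    simp only [sub_self, zero_add] at this
    exact lt_of_lt_of_le this hsp'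
  have h0 := Int.eq_zero_of_abs_lt_dvd hz hlt
  have hs : (s : ℤ) ≠ 0 := by exact_mod_cast (Nat.ne_of_gt (Nat.zero_lt_of_lt hj₁))
  have := (mul_eq_zero.mp h0).resolve_left hs
  omega

/-- (W) for every translate block (only `s*s ≤ p` is needed: four-term relations are integers of
absolute value `< s² ≤ p`). -/
lemma tr_W {p s : ℕ} (hsp : s * s ≤ p) (i : ℕ) :
    ∀ a ∈ trA p s i, ∀ a' ∈ trA p s i, ∀ b ∈ trB p s i, ∀ b' ∈ trB p s i,
      (a - a') + (b - b') = 0 → a = a' ∧ b = b' := by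
  intro a ha a' ha' b hb b' hb' h
  simp only [trA, trB, Finset.mem_image, Finset.mem_range] at ha ha' hb hb'
  obtain ⟨j₁, hj₁, rfl⟩ := ha
  obtain ⟨j₂, hj₂, rfl⟩ := ha'
  obtain ⟨j₃, hj₃, rfl⟩ := hb
  obtain ⟨j₄, hj₄, rfl⟩ := hb'
  have hz : (((((j₁ : ℤ) - j₂) + s * ((j₃ : ℤ) - j₄)) : ℤ) : ZMod p) = 0 := by
    push_cast at h ⊢
    linear_combination h
  rw [ZMod.intCast_zmod_eq_zero_iff_dvd] at hz
  have hsp' : (s : ℤ) * s ≤ p := by exact_mod_cast hsp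
  have h0 := Int.eq_zero_of_abs_lt_dvd hz (lt_of_lt_of_le (digits_abs_lt hj₁ hj₂ hj₃ hj₄) hsp')
  obtain ⟨rfl, rfl⟩ := digits_eq hj₁ hj₂ h0
  exact ⟨rfl, rfl⟩

/-- (X) for the translate family with `n·s² ≤ p`: a four-term relation is the integer
`(i − k)s² + r`, `|r| < s²`, `|i − k| < n`, of absolute value `< n s² ≤ p`, hence `0`, hence
`i = k`. -/
lemma tr_X {p s n : ℕ} (hn : n * (s * s) ≤ p) :
    ∀ i j k : Fin n, ∀ a ∈ trA p s i, ∀ a' ∈ trA p s j, ∀ b ∈ trB p s j, ∀ b' ∈ trB p s k,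
      (a - a') + (b - b') = 0 → i = k := by
  intro i j k a ha a' ha' b hb b' hb' h
  simp only [trA, trB, Finset.mem_image, Finset.mem_range] at ha ha' hb hb'
  obtain ⟨j₁, hj₁, rfl⟩ := ha
  obtain ⟨j₂, hj₂, rfl⟩ := ha'
  obtain ⟨j₃, hj₃, rfl⟩ := hb
  obtain ⟨j₄, hj₄, rfl⟩ := hb'
  set r : ℤ := ((j₁ : ℤ) - j₂) + s * ((j₃ : ℤ) - j₄) with hr
  have hz : ((((((i : ℕ) : ℤ) - ((k : ℕ) : ℤ)) * ((s : ℤ) * s) + r) : ℤ) : ZMod p) = 0 := by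
    rw [hr]
    push_cast at h ⊢
    linear_combination h
  rw [ZMod.intCast_zmod_eq_zero_iff_dvd] at hz
  have hrabs := abs_lt.mp (digits_abs_lt hj₁ hj₂ hj₃ hj₄)
  rw [← hr] at hrabs
  have hi : (((i : ℕ) : ℤ)) < n := by exact_mod_cast i.isLt
  have hk : (((k : ℕ) : ℤ)) < n := by exact_mod_cast k.isLt
  have hi0 : (0 : ℤ) ≤ ((i : ℕ) : ℤ) := Nat.cast_nonneg _
  have hk0 : (0 : ℤ) ≤ ((k : ℕ) : ℤ) := Nat.cast_nonneg _
  have hss : (0 : ℤ) ≤ (s : ℤ) * s := by positivity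
  have hn' : (n : ℤ) * ((s : ℤ) * s) ≤ p := by exact_mod_cast hn
  have up1 : (((i : ℕ) : ℤ) - ((k : ℕ) : ℤ)) * ((s : ℤ) * s) ≤ ((n : ℤ) - 1) * ((s : ℤ) * s) :=
    mul_le_mul_of_nonneg_right (by linarith) hss
  have lo1 : (1 - (n : ℤ)) * ((s : ℤ) * s) ≤ (((i : ℕ) : ℤ) - ((k : ℕ) : ℤ)) * ((s : ℤ) * s) :=
    mul_le_mul_of_nonneg_right (by linarith) hss
  have habs : |(((i : ℕ) : ℤ) - ((k : ℕ) : ℤ)) * ((s : ℤ) * s) + r| < (p : ℤ) := by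
    rw [abs_lt]; constructor <;> nlinarith
  have h0 := Int.eq_zero_of_abs_lt_dvd hz habs
  -- now (i - k) s² = -r with |r| < s²
  by_contra hik
  have hik' : ((i : ℕ) : ℤ) ≠ ((k : ℕ) : ℤ) := by
    intro e; exact hik (Fin.ext (by exact_mod_cast e))
  rcases lt_or_gt_of_ne hik' with hlt | hgt
  · have : (((i : ℕ) : ℤ) - ((k : ℕ) : ℤ)) * ((s : ℤ) * s) ≤ (-1) * ((s : ℤ) * s) :=
      mul_le_mul_of_nonneg_right (by linarith) hss
    nlinarith
  · have : (1 : ℤ) * ((s : ℤ) * s) ≤ (((i : ℕ) : ℤ) - ((k : ℕ) : ℤ)) * ((s : ℤ) * s) :=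
      mul_le_mul_of_nonneg_right (by linarith) hss
    nlinarith

/-- TIGHTNESS OF THE TRANSLATE BOUND, at every block size: for all `s ≥ 1` and every modulus
`p ≥ s²` the translate family has `n = ⌊p/s²⌋` blocks, i.e. `p < (n+1)s²`, so `n s > p/s − s`.
Consequently the crux's threshold must satisfy `s₀(ε) ≥ 1/ε − O(1)` (take `p ≥ s³`): the
density `1/s` is attained at EVERY `s`, and `translate_family_bound` is sharp. -/
theorem translate_bound_tight {p s : ℕ} (hs : 1 ≤ s) (hsp : s * s ≤ p) :
    ∃ (n : ℕ) (A B : Fin n → Finset (ZMod p)),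
      p < (n + 1) * (s * s) ∧
      (∀ i : Fin n, (A i).card = s ∧ (B i).card = s) ∧
      (∀ i : Fin n, ∀ a ∈ A i, ∀ a' ∈ A i, ∀ b ∈ B i, ∀ b' ∈ B i,
        (a - a') + (b - b') = 0 → a = a' ∧ b = b') ∧
      (∀ i j k : Fin n, ∀ a ∈ A i, ∀ a' ∈ A j, ∀ b ∈ B j, ∀ b' ∈ B k,
        (a - a') + (b - b') = 0 → i = k) := by
  have hss : 0 < s * s := Nat.mul_pos hs hs
  refine ⟨p / (s * s), fun i => trA p s i, fun i => trB p s i, ?_, ?_, ?_, ?_⟩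
  · have := Nat.lt_div_mul_add (a := p) hss
    linarith [this]
  · intro i
    exact ⟨card_trA (le_trans (Nat.le_mul_self s) hsp) i, card_trB hsp i⟩
  · intro i
    exact tr_W hsp i
  · exact tr_X (Nat.div_mul_le_self p (s * s))

/-! ## (c) Why it resists: the translate class is provably capped at density `1/s` -/

/-- TRANSLATE FAMILIES OBEY THE CRUX WITH ROOM TO SPARE.  If `A_i = t_i + A`, `B_i = t_i + B`
(`|A| = |B| = s`, (W) for the pair, (X) for the family) then `n·s² ≤ p`: the `n` translates
`t_i + (A + B)` have `s²` elements each by (W) and are pairwise disjoint by (X) (a common element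
`t_i + a₁ + b₁ = t_k + a₂ + b₂` gives the forbidden relation
`(t_i + a₁) − (t_k + a₂) + (t_k + b₁) − (t_k + b₂) = 0` with pattern `(i, k, k, k)`).
So density `ns/p ≤ 1/s`, the crux holds on this class with `s₀ = ⌈1/ε⌉ + 1`, and — since the exact
`s = 2` census is attained by translates — a refutation needs a genuinely different design paradigm. -/
theorem translate_family_bound {p : ℕ} [NeZero p] {n s : ℕ} (A B : Finset (ZMod p))
    (t : Fin n → ZMod p) (hA : A.card = s) (hB : B.card = s)
    (hW : ∀ a ∈ A, ∀ a' ∈ A, ∀ b ∈ B, ∀ b' ∈ B, (a - a') + (b - b') = 0 → a = a' ∧ b = b')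
    (hX : ∀ i j k : Fin n, ∀ a ∈ A.image (t i + ·), ∀ a' ∈ A.image (t j + ·), ∀ b ∈ B.image (t j + ·),
      ∀ b' ∈ B.image (t k + ·), (a - a') + (b - b') = 0 → i = k) :
    n * s ^ 2 ≤ p := by
  classical
  set AB : Finset (ZMod p) := (A ×ˢ B).image (fun ab : ZMod p × ZMod p => ab.1 + ab.2) with hABdef
  have hAB : AB.card = s ^ 2 := by
    rw [hABdef, Finset.card_image_of_injOn, Finset.card_product, hA, hB, sq]
    rintro ⟨a, b⟩ hab ⟨a', b'⟩ hab' h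
    simp only [Finset.coe_product, Set.mem_prod, Finset.mem_coe] at hab hab'
    have h' : a + b = a' + b' := h
    obtain ⟨rfl, rfl⟩ := hW a hab.1 a' hab'.1 b hab.2 b' hab'.2 (by linear_combination h')
    rfl
  set S : Fin n → Finset (ZMod p) := fun i => AB.image (t i + ·) with hSdef
  have hS : ∀ i, (S i).card = s ^ 2 := fun i => by
    rw [hSdef, Finset.card_image_of_injective _ (add_right_injective (t i)), hAB]
  have hdisj : Set.PairwiseDisjoint (↑(Finset.univ : Finset (Fin n))) S := by
    intro i _ k _ hik
    rw [Function.onFun, Finset.disjoint_left]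
    intro z hzi hzk
    simp only [hSdef, hABdef, Finset.mem_image, Finset.mem_product, Prod.exists] at hzi hzk
    obtain ⟨_, ⟨a₁, b₁, ⟨ha₁, hb₁⟩, rfl⟩, rfl⟩ := hzi
    obtain ⟨_, ⟨a₂, b₂, ⟨ha₂, hb₂⟩, rfl⟩, hk⟩ := hzk
    apply hik
    refine hX i k k (t i + a₁) ?_ (t k + a₂) ?_ (t k + b₁) ?_ (t k + b₂) ?_ ?_
    · exact Finset.mem_image.mpr ⟨a₁, ha₁, rfl⟩
    · exact Finset.mem_image.mpr ⟨a₂, ha₂, rfl⟩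
    · exact Finset.mem_image.mpr ⟨b₁, hb₁, rfl⟩
    · exact Finset.mem_image.mpr ⟨b₂, hb₂, rfl⟩
    · linear_combination (-1 : ZMod p) * hk
  have hcard := Finset.card_biUnion hdisj
  have hle : (Finset.univ.biUnion S).card ≤ Fintype.card (ZMod p) := Finset.card_le_univ _
  rw [ZMod.card] at hle
  calc n * s ^ 2 = ∑ _i : Fin n, s ^ 2 := by simp
    _ = ∑ i : Fin n, (S i).card := by simp [hS]
    _ = (Finset.univ.biUnion S).card := hcard.symm
    _ ≤ p := hle

/-- Corollary: the crux restricted to translate families, with the explicit threshold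
`s₀ = ⌈1/ε⌉₊ + 1`. -/
theorem primeDensityDecay_of_translates (ε : ℝ) (hε : 0 < ε) :
    ∃ s₀ : ℕ, ∀ p : ℕ, p.Prime → ∀ (n s : ℕ) (A B : Finset (ZMod p)) (t : Fin n → ZMod p), s₀ ≤ s →
      A.card = s → B.card = s →
      (∀ a ∈ A, ∀ a' ∈ A, ∀ b ∈ B, ∀ b' ∈ B, (a - a') + (b - b') = 0 → a = a' ∧ b = b') →
      (∀ i j k : Fin n, ∀ a ∈ A.image (t i + ·), ∀ a' ∈ A.image (t j + ·), ∀ b ∈ B.image (t j + ·),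
        ∀ b' ∈ B.image (t k + ·), (a - a') + (b - b') = 0 → i = k) →
      (n : ℝ) * (s : ℝ) ≤ ε * (p : ℝ) := by
  refine ⟨⌈1 / ε⌉₊ + 1, ?_⟩
  intro p hp n s A B t hs hA hB hW hX
  haveI : NeZero p := ⟨hp.ne_zero⟩
  have hb := translate_family_bound A B t hA hB hW hX
  have hb' : (n : ℝ) * (s : ℝ) ^ 2 ≤ (p : ℝ) := by exact_mod_cast hb
  have hs1 : (1 / ε : ℝ) < s := by
    have h1 : (⌈1 / ε⌉₊ : ℝ) < ((⌈1 / ε⌉₊ + 1 : ℕ) : ℝ) := by push_cast; linarith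
    have h2 : (((⌈1 / ε⌉₊ + 1 : ℕ) : ℝ)) ≤ s := by exact_mod_cast hs
    exact lt_of_le_of_lt (Nat.le_ceil _) (lt_of_lt_of_le h1 h2)
  have hspos : (0 : ℝ) < s := lt_trans (by positivity) hs1
  have hεs : 1 < ε * s := by
    have := (div_lt_iff₀ hε).mp hs1
    linarith [this]
  have hn : (0 : ℝ) ≤ n := Nat.cast_nonneg n
  calc (n : ℝ) * s ≤ (n : ℝ) * s * (ε * s) := by
        have : 0 ≤ (n : ℝ) * s := mul_nonneg hn hspos.le
        nlinarith
    _ = ε * ((n : ℝ) * (s : ℝ) ^ 2) := by ring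
    _ ≤ ε * p := by exact mul_le_mul_of_nonneg_left hb' hε.le


/-! ## (c') Exclusion zones and the common-pattern bound (stronger than the translate bound) -/

/-- EXCLUSION ZONES.  Under (W)+(X): for every block `i`, every `b ∈ B_i` and all `a ≠ a'` in `A_i`,
the point `b + (a − a')` lies in NO block `B_k` (neither `k = i`, by (W), nor `k ≠ i`, by (X) with the
index pattern `(i,i,i,k)`).  Dually `a + (b − b') ∉ A_k`.  So around each `B_i` the set
`B_i + (A_i − A_i)∖{0}` (size `≥ s² − s`) is free of `Y = ⋃ B_k`: density `> 1/s` forces these zones to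
overlap heavily (`Σ_i |zone_i| ≈ n s² > p`, the WallBreach regime). -/
theorem exclusion_zone {p n : ℕ} (A B : Fin n → Finset (ZMod p))
    (hW : ∀ i : Fin n, ∀ a ∈ A i, ∀ a' ∈ A i, ∀ b ∈ B i, ∀ b' ∈ B i,
      (a - a') + (b - b') = 0 → a = a' ∧ b = b')
    (hX : ∀ i j k : Fin n, ∀ a ∈ A i, ∀ a' ∈ A j, ∀ b ∈ B j, ∀ b' ∈ B k,
      (a - a') + (b - b') = 0 → i = k)
    (i k : Fin n) {a a' b : ZMod p} (ha : a ∈ A i) (ha' : a' ∈ A i) (hb : b ∈ B i) (hne : a ≠ a') :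
    b + (a - a') ∉ B k := by
  intro hb'
  have hik : i = k := hX i i k a ha a' ha' b hb (b + (a - a')) hb' (by ring)
  subst hik
  exact hne (hW i a ha a' ha' b hb (b + (a - a')) hb' (by ring)).1

/-- (X) alone makes the `B`-blocks pairwise disjoint (pattern `(i,i,i,k)` with `a = a'`), provided the
`A`-blocks are nonempty. -/
theorem B_disjoint {p n : ℕ} (A B : Fin n → Finset (ZMod p))
    (hX : ∀ i j k : Fin n, ∀ a ∈ A i, ∀ a' ∈ A j, ∀ b ∈ B j, ∀ b' ∈ B k,
      (a - a') + (b - b') = 0 → i = k)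
    (hA : ∀ i, (A i).Nonempty) {i k : Fin n} (hik : i ≠ k) : Disjoint (B i) (B k) := by
  rw [Finset.disjoint_left]
  intro b hbi hbk
  obtain ⟨a, ha⟩ := hA i
  exact hik (hX i i k a ha a ha b hbi b hbk (by ring))

/-- COMMON-PATTERN BOUND.  If every `A`-block contains a translate of one pattern `E`
(`t_i + E ⊆ A_i`), the `B`-blocks being ARBITRARY `s`-sets, then (W)+(X) force `n·s·|E| ≤ p`:
`Y = ⋃ B_i` has `n s` elements and `(y, e) ↦ y + e` is injective on `Y × E` by `exclusion_zone`.
With `E = A` (all `A_i` translates of one `s`-set) this is `n s² ≤ p`, density `≤ 1/s`, whatever the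
`B_i` are; with `|E| = 2` it says: blocks sharing one internal difference `d` fill density `≤ 1/2`.
Robust form: for any pattern `E`, at most `p/(s|E|)` blocks of an SDPP family contain a translate
of `E` (apply the bound to that sub-family). -/
theorem common_pattern_bound {p : ℕ} [NeZero p] {n s : ℕ} (A B : Fin n → Finset (ZMod p))
    (E : Finset (ZMod p)) (t : Fin n → ZMod p)
    (hB : ∀ i, (B i).card = s) (hE : ∀ i, E.image (t i + ·) ⊆ A i)
    (hW : ∀ i : Fin n, ∀ a ∈ A i, ∀ a' ∈ A i, ∀ b ∈ B i, ∀ b' ∈ B i,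
      (a - a') + (b - b') = 0 → a = a' ∧ b = b')
    (hX : ∀ i j k : Fin n, ∀ a ∈ A i, ∀ a' ∈ A j, ∀ b ∈ B j, ∀ b' ∈ B k,
      (a - a') + (b - b') = 0 → i = k) :
    n * s * E.card ≤ p := by
  classical
  rcases E.eq_empty_or_nonempty with hE0 | ⟨e₀, he₀⟩
  · simp [hE0]
  have hAne : ∀ i, (A i).Nonempty := fun i => ⟨t i + e₀, hE i (Finset.mem_image.mpr ⟨e₀, he₀, rfl⟩)⟩
  set Y : Finset (ZMod p) := Finset.univ.biUnion B with hYdef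
  have hYcard : Y.card = n * s := by
    have hdisj : Set.PairwiseDisjoint (↑(Finset.univ : Finset (Fin n))) B :=
      fun i _ k _ hik => B_disjoint A B hX hAne hik
    rw [hYdef, Finset.card_biUnion hdisj]
    simp [hB]
  -- the map (y, e) ↦ y + e is injective on Y × E
  set YE : Finset (ZMod p) := (Y ×ˢ E).image (fun ye : ZMod p × ZMod p => ye.1 + ye.2) with hYEdef
  have hYE : YE.card = n * s * E.card := by
    rw [hYEdef, Finset.card_image_of_injOn, Finset.card_product, hYcard]
    rintro ⟨y, e⟩ hye ⟨y', e'⟩ hye' h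
    simp only [Finset.coe_product, Set.mem_prod, Finset.mem_coe] at hye hye'
    have h' : y + e = y' + e' := h
    obtain ⟨⟨hy, he⟩, ⟨hy', he'⟩⟩ := And.intro hye hye'
    rw [hYdef, Finset.mem_biUnion] at hy hy'
    obtain ⟨i, -, hyi⟩ := hy
    obtain ⟨k, -, hyk⟩ := hy'
    by_cases hee : e = e'
    · subst hee
      have : y = y' := add_right_cancel h'
      subst this
      rfl
    · exfalso
      have hmem : y + ((t i + e) - (t i + e')) ∈ B k := by
        have : y + ((t i + e) - (t i + e')) = y' := by linear_combination h'
        rw [this]; exact hyk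
      refine exclusion_zone A B hW hX i k (hE i ?_) (hE i ?_) hyi ?_ hmem
      · exact Finset.mem_image.mpr ⟨e, he, rfl⟩
      · exact Finset.mem_image.mpr ⟨e', he', rfl⟩
      · intro h2; exact hee (add_left_cancel h2)
  have hle : YE.card ≤ Fintype.card (ZMod p) := Finset.card_le_univ _
  rwa [ZMod.card, hYE] at hle

/-- The translate bound again, now with ARBITRARY `B`-blocks: all `A_i = t_i + A` ⇒ `n s² ≤ p`. -/
theorem A_translates_bound {p : ℕ} [NeZero p] {n s : ℕ} (A₀ : Finset (ZMod p)) (t : Fin n → ZMod p)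
    (A B : Fin n → Finset (ZMod p)) (hA₀ : A₀.card = s) (hA : ∀ i, A i = A₀.image (t i + ·))
    (hB : ∀ i, (B i).card = s)
    (hW : ∀ i : Fin n, ∀ a ∈ A i, ∀ a' ∈ A i, ∀ b ∈ B i, ∀ b' ∈ B i,
      (a - a') + (b - b') = 0 → a = a' ∧ b = b')
    (hX : ∀ i j k : Fin n, ∀ a ∈ A i, ∀ a' ∈ A j, ∀ b ∈ B j, ∀ b' ∈ B k,
      (a - a') + (b - b') = 0 → i = k) :
    n * s ^ 2 ≤ p := by
  have h := common_pattern_bound A B A₀ t hB (fun i => (hA i).symm ▸ le_refl _) hW hX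
  rw [hA₀] at h
  simpa [sq, mul_assoc] using h


/-! ## (c'') Quantitative pattern diversity and the induced-block identity -/

/-- PATTERN MULTIPLICITY BOUND (robust form of `common_pattern_bound`): in ANY family satisfying
(W)+(X) with `|B_i| = s`, the blocks whose `A`-set contains a translate of a fixed pattern `E` are
at most `p / (s·|E|)` in number.  So a family of density `α = ns/p` has at most a fraction
`1/(α·|E|)` of its blocks sharing any `|E|`-point pattern: dense designs are pattern-diverse at
scale `1/α` (no common AP piece, no common digit box, … of more than `1/α` points). -/
theorem pattern_multiplicity_bound {p : ℕ} [NeZero p] {n s : ℕ} (A B : Fin n → Finset (ZMod p))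
    (E : Finset (ZMod p)) (t : Fin n → ZMod p) (S : Finset (Fin n))
    (hB : ∀ i, (B i).card = s) (hE : ∀ i ∈ S, E.image (t i + ·) ⊆ A i)
    (hW : ∀ i : Fin n, ∀ a ∈ A i, ∀ a' ∈ A i, ∀ b ∈ B i, ∀ b' ∈ B i,
      (a - a') + (b - b') = 0 → a = a' ∧ b = b')
    (hX : ∀ i j k : Fin n, ∀ a ∈ A i, ∀ a' ∈ A j, ∀ b ∈ B j, ∀ b' ∈ B k,
      (a - a') + (b - b') = 0 → i = k) :
    S.card * s * E.card ≤ p := by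
  classical
  -- restrict the family to the index set S, reindexed by Fin S.card
  set e := S.equivFin with he
  let ι : Fin S.card → Fin n := fun m => (e.symm m).1
  have hι : ∀ m, ι m ∈ S := fun m => (e.symm m).2
  have hιinj : Function.Injective ι := by
    intro m m' h
    exact e.symm.injective (Subtype.ext h)
  have h := common_pattern_bound (p := p) (n := S.card) (s := s)
    (fun m => A (ι m)) (fun m => B (ι m)) E (fun m => t (ι m))
    (fun m => hB (ι m)) (fun m => hE (ι m) (hι m))
    (fun m => hW (ι m))
    (fun m m' m'' a ha a' ha' b hb b' hb' hrel => hιinj (hX (ι m) (ι m') (ι m'') a ha a' ha' b hb b' hb' hrel))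
  simpa using h

/-- INDUCED-BLOCK IDENTITY: for `x ∈ A_i`, the elements `y ∈ Y = ⋃ B_k` with `x − y ∈ D = ⋃_j (A_j − B_j)`
are EXACTLY `B_i` ((X) with the pattern `(i, j, j, k)`).  Hence `Y` meets every translate `x − D`,
`x ∈ X`, in `s` points although `|D| ≥ s²` by (W): relative density `≤ 1/s` of `Y` on `X − D`, the
`1/s`-porosity that every increment argument starts from. -/
theorem induced_block {p n : ℕ} (A B : Fin n → Finset (ZMod p))
    (hX : ∀ i j k : Fin n, ∀ a ∈ A i, ∀ a' ∈ A j, ∀ b ∈ B j, ∀ b' ∈ B k,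
      (a - a') + (b - b') = 0 → i = k)
    (i : Fin n) {x : ZMod p} (hx : x ∈ A i) :
    (Finset.univ.biUnion B).filter
        (fun y => ∃ j : Fin n, ∃ a' ∈ A j, ∃ b'' ∈ B j, x - y = a' - b'') = B i := by
  classical
  ext y
  simp only [Finset.mem_filter, Finset.mem_biUnion, Finset.mem_univ, true_and]
  constructor
  · rintro ⟨⟨k, hyk⟩, j, a', ha', b'', hb'', hrel⟩
    have hik : i = k := hX i j k x hx a' ha' b'' hb'' y hyk (by linear_combination hrel)
    subst hik
    exact hyk
  · intro hy
    exact ⟨⟨i, hy⟩, i, x, hx, y, hy, rfl⟩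

/-! ## PARADIGM NOTES (paper analysis; no declaration)

PARADIGM NOTES (why each known construction class stays far from density `ε₀ > 0`).
Write `X = ⊔ A_i`, `Y = ⊔ B_i`, `D = ⋃_j (A_j − B_j)`; (X) ⇔ `(A_i − B_k) ∩ D = ∅ (i ≠ k)`.
1. Translates / common `A`-pattern: `common_pattern_bound` (Lean) — density `≤ 1/|E|`.
2. Common difference set (`A_i − B_i = D₀ ∀ i`, e.g. all digit factorisations
   `[0,s²) = Box(S) + Box(Sᶜ)`): cross sets `Box(S_i)+Box(S_kᶜ)` have no gap of length `s²`, so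
   offsets must be `≥ 2s²` apart: density `≤ 1/(2s)`.
3. 2-D segments (`A_i` vertical, `B_i` horizontal in `ℤ/M₁ × ℤ/M₂`): (X) for the pair `(i,k,k)`
   forces the base points to be `s`-separated in sup-norm: `n ≤ M₁M₂/s²`, density `≤ 1/s`.
4. Product alphabets in `(ℤ/M)^m` (letters `(P,Q)`, `P ⊖ Q` direct; code condition
   `∀ w ≠ w' ∀ w'' ∃ c, (P_{w_c} − Q_{w'_c}) ∩ (P_{w''_c} − Q_{w''_c}) = ∅`): contains CKSU Prop 4.5
   (Sperner/antichain codes) and its translates (a subgroup `U` of translations is the same as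
   `M ↦ M/|U|`).  Balance pins the composition class; near-full rate for a whole class would make
   the alphabet itself an SDPP family of density `1` in `ℤ/M` — impossible — so rate `< log M`
   strictly and density decays exponentially in `m`, polynomially in `s`.  Records: all-abelian
   `(8/9)^l/√l ≈ s^(-0.17)` (`M = 3`), cyclic (digits `{2..M-1}`, carries absorbed at a zero digit)
   `≈ s^(-0.546)` (`M ≈ 9`).
5. Line designs in `(ℤ/M)^k` (`A_i`, `B_i` coordinate lines, `s = M − 1`): `n ≈ εM^(k-1)` lines
   are needed but a line's base point has two forced zeros, so `k² M^(k-2) ≥ εM^(k-1)`, `k ≳ √(εM)`;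
   with `b_i = a_i − 𝟙` off the two directions, same-direction-pair blocks need a distance-3 code
   (Hamming: fine, density `≈ k/M²` if `k ≈ εM²`), but every base point then has `≈ M⁷` partners at
   Hamming distance `≤ 4` in each other direction pair, each of which must be rescued by a zero /
   `−1` coincidence; global parity checks of redundancy `r` push `k` to `M^(r+1)` and the number of
   dangerous partners to `M^(r+6)`.  The sparse (matching) variant with entries in `{2..M-1}` is
   clean but has density `(k/2M³)(1−2/M)^k → 0`.
6. Multiplicative designs in `F_p` (blocks = cosets/dilates under `Γ ≤ F_p^×`): (X) needs the
   `Γ`-classes of `1 − uΓ` and of `1 − u(X∖Γ)` to be disjoint, but `|X∖Γ| ≫ (p−1)/|X|` classes are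
   all hit (cyclotomic numbers `p/r² + O(√p)`), so `D` meets everything.
7. Random / greedy: representation counts `α²p|D| ≫ αps` — hopeless by a factor `αs`.
8. Two-level designs (a base family `ℱ₀ = {(A_τ,B_τ)}_{τ<L}` replicated along a shift set `Λ`,
   blocks `(A_τ + t, B_τ + t)`): valid iff `ℱ₀` is SDPP and `(Λ − Λ)∖0` avoids
   `F = D₀ + Y₀ − X₀ ⊇ (A_τ+B_τ) − (A_τ+B_τ)`, so `|Λ| ≤ p/s²` (packing), density `≤ L/s`, hence
   `L ≳ εs` base blocks; if `ℱ₀` sits in a window of length `W` then `Λ` is `2W`-separated, forcing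
   `W ≈ s²` and a base family of density `≈ 2ε` with `n₀ = L ≈ εs ≤ K·s₀` blocks — the REMOVAL
   REGIME, where decay is proved (support item RemovalRegime).  So flat two-level replication
   provably fails asymptotically; porous `F` means a multi-scale base, i.e. digit designs (item 4).
Necessary features of a counterexample: `n/s → ∞`, `s² = o(p)`, `Σ_i |B_i + (A_i−A_i)| ≈ ns² ≫ p`
with heavily overlapping exclusion zones, block patterns diverse at scale `1/ε`, and `D` biased
(`|μ̂_D(ξ)| ≥ α − 1/s` at some `ξ ≠ 0`, from `1_Y ∗ μ_{−D} ≤ 1/s` on `X`). -/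

end Summit.MatrixMultiplication.MatrixMultiplication.Cruxes.PrimeDensityDecay.Disproof
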